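import Summits.QuantumFields.BalabanUV.Gaps.D1PinnedBorderWeightAffine
import Summits.QuantumFields.BalabanUV.Gaps.D1PinnedSecondOrderModular
import Summits.QuantumFields.BalabanUV.Gaps.D1PinnedPositionTableAffine
import Summits.QuantumFields.BalabanUV.Gaps.D1PinnedSecondOrderUniversal
import Summits.QuantumFields.BalabanUV.Gaps.D1PinnedTableResponseUniversal
import Summits.QuantumFields.BalabanUV.Gaps.D1PinnedColourResponseUniversal

/-!
# `BalabanUV.Gaps.D1PinnedSecondOrderNormalForm` — cell pub-balaban-gaps, row (D1), seat g1-p1: THE NORMAL FORM OF THE PINNED FAMILY's LIMIT COEFFICIENT IN ITS FREE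
# SECOND-ORDER DATA — `lim β⁰(r, c⃗; cB, Tc) = lim β⁰(r, c⃗; 0, 0) + cB·σ_r + λ(Tc)` with `σ_r := lim β⁰(r,0⃗;1,0) − lim β⁰(r,0⃗;0,0)` (free of `c⃗`, `Tc`) and
# `λ(Tc) := lim β⁰(r₀,0⃗;0,Tc) − lim β⁰(r₀,0⃗;0,0)` (linear; free of `r`, `c⃗`, `cB`) — and the resulting TRICHOTOMY for (D1) at the β-lead's pinned literal, hypothesis-free

HONEST FRAMING (cell rule, page 1 of everything): [folklore] five-line compositions BY NAME of this seat's `Gaps/D1PinnedBorderWeightAffine` (GEN 9, p370181: affine in `cB`),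
`Gaps/D1PinnedSecondOrderModular` (no cross term), `Gaps/D1PinnedPositionTableAffine` v2 (affine ∕ linear in `Tc`), `Gaps/D1PinnedSecondOrderUniversal` (response free of
`c⃗ = (cE,cVH,cΛ)`), `Gaps/D1PinnedTableResponseUniversal` (table response free of root, `c⃗`, `cB`), `Gaps/D1PinnedColourResponseUniversal` (colour response free of root, `cB`, `Tc`) — all GEN 10 — and g1-p3's `CapTailPinnedLimitSign.d1Drift_pinned_iff_lim_eq`.
NOTHING of Bałaban's is asserted beyond print; [Balaban1987RG1] Thm 2 is UNPROVED IN PRINT; which `cB`, `Tc`, root and colour constants are print's is NOT decided here ((P6));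
WHETHER `σ_r = 0` and WHETHER `λ = 0` — the BLIND ∕ GENERIC alternative — is NOT decided (a computation on an4's kernel tower, an1's border, an3's `wilsonW₂` and the pin, free
of every colour constant); 0 coefficients certified; (D1) NOT discharged at any literal; 0∕4 row-D1 binders; NOT `BetaPertH`, NOT the continuum limit, NOT Clay.
HONEST DEPENDENCY (b2b cell, verbatim): «continuum YM on T⁴ ⇐ BetaPertH ∧ nine spine estimates (0/9 proved); BetaPertH ⇐ (D1) ∧ (D4) ∧ CAP+tail; G-an2-4 gates asym, D1
and NE2/3/4.»

CONTENT (all [folklore]; no `def`, no `def … : Prop`, nothing cited as a hypothesis, 0 sorry; `2 ≤ Lc`, the pin `cE₂ := Lc^8`, roots `r, r₀ ∈ box (3+1) Lc`, any channel):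
* §1 **`lim_normalForm`** — the displayed normal form (reference root `r₀` for the table response arbitrary); **`lim_fourPieces`** — the FULL separation
  `lim β⁰(r,c⃗;cB,Tc) = γ(r) + φ(c⃗) + cB·σ(r) + λ(Tc)` with `φ(c⃗) := lim β⁰(r₀,c⃗;0,0) − lim β⁰(r₀,0⃗;0,0)` root-free; **`d1Drift_iff_fourPieces`**.
* §2 **`d1Drift_iff_normalForm`** — (D1) at `(r,c⃗;cB,Tc)` ⟺ `lim β⁰(r,c⃗;0,0) + cB·σ_r + λ(Tc) = stepBal N Lc`.
* §3 TRICHOTOMY: **`existsUnique_borderWeight_of_sigma_ne`** (`σ_r ≠ 0` ⟹ for EVERY colour triple, table and numeral EXACTLY ONE border weight meets (D1));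
  **`exists_table_met_and_missed_of_lambda_ne`** (`λ(T) ≠ 0` for some `T` ⟹ for every colour triple, border weight and numeral SOME table meets (D1) and
  SOME table misses it); **`d1Drift_iff_base_of_sigma_eq_lambda_eq`** (`σ_r = 0`, `λ = 0` ⟹ (D1) sees NONE of its free second-order data at any member over the root `r`); **`trichotomy`** (the three cases exhaust).
READING (zero classification weight): at the β-lead's pinned literal, (D1) is — per root and channel — EITHER one affine equation DEFINING print's border weight (case A), OR an
affine hyperplane condition on print's position table (case B), OR blind to both (case C), and which case holds is free of every colour constant; in cases A∕B the literal's
(D1) weighs for the wall exactly as much as print's values of `cB` ∕ `Tc` ((P6)); in case C it is a statement about `(cE,cVH,cΛ)` alone.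

Provenance: cell pub-balaban-gaps, seat g1-p1 GEN 10 (prover-pub-balaban-gaps-g1-p1-g10-0), 2026-08-23; imports the six sibling files ONLY (needs their oleans); no existing file touched.
-/

noncomputable section

open Literature.MathematicalPhysics.QuantumFieldTheory Balaban1983to89 Balaban1983to89.Beta Filter Topology
open OneStepKernelFamily (TbalOf D1Drift)
open AffineAveraging (box)
open RateCertificate (CauchyRate)
open Summit.QuantumFields.BalabanUV.Beta.MixedJetTablesPlug (JsBalAn1)
open Summit.QuantumFields.BalabanUV.Beta.GAN24.StencilSlotOfE3 (one_le_of_two_le)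
open Summit.QuantumFields.BalabanUV.Gaps.CapTailPinnedLimitSign (d1Drift_pinned_iff_lim_eq)
open Summit.QuantumFields.BalabanUV.Gaps.D1PinnedBorderWeightAffine (lim_JsBalAn1_borderWeight_affine)
open Summit.QuantumFields.BalabanUV.Gaps.D1PinnedSecondOrderModular (lim_JsBalAn1_secondOrder_modular)
open Summit.QuantumFields.BalabanUV.Gaps.D1PinnedPositionTableAffine (lim_JsBalAn1_table_affine lim_JsBalAn1_table_smul)
open Summit.QuantumFields.BalabanUV.Gaps.D1PinnedSecondOrderUniversal (lim_JsBalAn1_response_universal)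
open Summit.QuantumFields.BalabanUV.Gaps.D1PinnedTableResponseUniversal (lim_JsBalAn1_tableResponse_universal)
open Summit.QuantumFields.BalabanUV.Gaps.D1PinnedColourResponseUniversal (lim_JsBalAn1_colourSwap)

namespace Summit.QuantumFields.BalabanUV.Gaps.D1PinnedSecondOrderNormalForm

variable {Lc : ℕ} [NeZero Lc] {r r₀ : Fin (3 + 1) → ℕ}

/-! ## §1 The normal form -/

/-- [folklore] **NORMAL FORM OF THE PINNED FAMILY's LIMIT COEFFICIENT IN ITS FREE SECOND-ORDER DATA, HYPOTHESIS-FREE**: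
`lim β⁰(r,c⃗;cB,Tc) = lim β⁰(r,c⃗;0,0) + cB·(lim β⁰(r,0⃗;1,0) − lim β⁰(r,0⃗;0,0)) + (lim β⁰(r₀,0⃗;0,Tc) − lim β⁰(r₀,0⃗;0,0))`, `0⃗ = (0,0,0)`, for ANY reference root `r₀`
(modular law at `(r,c⃗)` + affinity in `cB` at `(r,c⃗,Tc := 0)` + universality of the border slope in `c⃗` + universality of the table response in `(r,c⃗,cB)`). -/
theorem lim_normalForm (hLc : 2 ≤ Lc) (hr : r ∈ box (3 + 1) Lc) (hr₀ : r₀ ∈ box (3 + 1) Lc) (cE cVH cΛ cB : ℝ)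
    (Tc : Fin 4 → Fin 4 → Fin 4 → Fin 4 → ℝ) (μ ν : Fin 4) :
    CauchyRate.lim (fun j => B12Beta.secondMoment (TbalOf Lc (JsBalAn1 (one_le_of_two_le hLc) hr cE cVH cΛ ((Lc : ℝ) ^ (2 * (3 + 1))) cB Tc) j) μ ν) =
      CauchyRate.lim (fun j => B12Beta.secondMoment (TbalOf Lc (JsBalAn1 (one_le_of_two_le hLc) hr cE cVH cΛ ((Lc : ℝ) ^ (2 * (3 + 1))) 0 0) j) μ ν) +
        cB * (CauchyRate.lim (fun j => B12Beta.secondMoment (TbalOf Lc (JsBalAn1 (one_le_of_two_le hLc) hr 0 0 0 ((Lc : ℝ) ^ (2 * (3 + 1))) 1 0) j) μ ν) - CauchyRate.lim (fun j => B12Beta.secondMoment (TbalOf Lc (JsBalAn1 (one_le_of_two_le hLc) hr 0 0 0 ((Lc : ℝ) ^ (2 * (3 + 1))) 0 0) j) μ ν)) +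
        (CauchyRate.lim (fun j => B12Beta.secondMoment (TbalOf Lc (JsBalAn1 (one_le_of_two_le hLc) hr₀ 0 0 0 ((Lc : ℝ) ^ (2 * (3 + 1))) 0 Tc) j) μ ν) - CauchyRate.lim (fun j => B12Beta.secondMoment (TbalOf Lc (JsBalAn1 (one_le_of_two_le hLc) hr₀ 0 0 0 ((Lc : ℝ) ^ (2 * (3 + 1))) 0 0) j) μ ν)) := by
  have hmod := lim_JsBalAn1_secondOrder_modular hLc hr cE cVH cΛ cB Tc μ ν
  have haff := lim_JsBalAn1_borderWeight_affine hLc hr cE cVH cΛ cB 0 μ ν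
  have hσ := lim_JsBalAn1_response_universal hLc hr cE cVH cΛ 0 0 0 1 0 μ ν
  have hlam := lim_JsBalAn1_tableResponse_universal hLc hr hr₀ cE cVH cΛ 0 0 0 0 0 Tc μ ν
  linear_combination hmod + haff + cB * hσ + hlam

/-- [folklore] **FULL ADDITIVE SEPARATION OF THE PINNED FAMILY's LIMIT COEFFICIENT INTO FOUR UNIVERSAL PIECES, HYPOTHESIS-FREE**: for ANY reference root `r₀`,
`lim β⁰(r,c⃗;cB,Tc) = lim β⁰(r,0⃗;0,0) + (lim β⁰(r₀,c⃗;0,0) − lim β⁰(r₀,0⃗;0,0)) + cB·(lim β⁰(r,0⃗;1,0) − lim β⁰(r,0⃗;0,0)) + (lim β⁰(r₀,0⃗;0,Tc) − lim β⁰(r₀,0⃗;0,0))`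
= `γ(r) + φ(c⃗) + cB·σ(r) + λ(Tc)`: the ROOT enters only the two colour-free numbers `γ(r), σ(r)`; the FIRST-ORDER COLOUR TRIPLE only the root-free, border-free, table-free
`φ(c⃗)` (`φ(0⃗) = 0`); the BORDER WEIGHT only linearly with the colour-free slope `σ(r)`; the POSITION TABLE only through the linear functional `λ` (`Gaps/D1PinnedColourResponseUniversal`
+ `lim_normalForm`). -/
theorem lim_fourPieces (hLc : 2 ≤ Lc) (hr : r ∈ box (3 + 1) Lc) (hr₀ : r₀ ∈ box (3 + 1) Lc) (cE cVH cΛ cB : ℝ)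
    (Tc : Fin 4 → Fin 4 → Fin 4 → Fin 4 → ℝ) (μ ν : Fin 4) :
    CauchyRate.lim (fun j => B12Beta.secondMoment (TbalOf Lc (JsBalAn1 (one_le_of_two_le hLc) hr cE cVH cΛ ((Lc : ℝ) ^ (2 * (3 + 1))) cB Tc) j) μ ν) =
      CauchyRate.lim (fun j => B12Beta.secondMoment (TbalOf Lc (JsBalAn1 (one_le_of_two_le hLc) hr 0 0 0 ((Lc : ℝ) ^ (2 * (3 + 1))) 0 0) j) μ ν) +
        (CauchyRate.lim (fun j => B12Beta.secondMoment (TbalOf Lc (JsBalAn1 (one_le_of_two_le hLc) hr₀ cE cVH cΛ ((Lc : ℝ) ^ (2 * (3 + 1))) 0 0) j) μ ν) - CauchyRate.lim (fun j => B12Beta.secondMoment (TbalOf Lc (JsBalAn1 (one_le_of_two_le hLc) hr₀ 0 0 0 ((Lc : ℝ) ^ (2 * (3 + 1))) 0 0) j) μ ν)) +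
        cB * (CauchyRate.lim (fun j => B12Beta.secondMoment (TbalOf Lc (JsBalAn1 (one_le_of_two_le hLc) hr 0 0 0 ((Lc : ℝ) ^ (2 * (3 + 1))) 1 0) j) μ ν) - CauchyRate.lim (fun j => B12Beta.secondMoment (TbalOf Lc (JsBalAn1 (one_le_of_two_le hLc) hr 0 0 0 ((Lc : ℝ) ^ (2 * (3 + 1))) 0 0) j) μ ν)) +
        (CauchyRate.lim (fun j => B12Beta.secondMoment (TbalOf Lc (JsBalAn1 (one_le_of_two_le hLc) hr₀ 0 0 0 ((Lc : ℝ) ^ (2 * (3 + 1))) 0 Tc) j) μ ν) - CauchyRate.lim (fun j => B12Beta.secondMoment (TbalOf Lc (JsBalAn1 (one_le_of_two_le hLc) hr₀ 0 0 0 ((Lc : ℝ) ^ (2 * (3 + 1))) 0 0) j) μ ν)) := by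
  have hcol := lim_JsBalAn1_colourSwap hLc hr hr₀ cE cVH cΛ 0 0 0 cB 0 Tc 0 μ ν
  have hnf := lim_normalForm hLc hr hr₀ 0 0 0 cB Tc μ ν
  linear_combination hcol + hnf

/-- [folklore] **(D1) AT THE PINNED LITERAL, FULLY SEPARATED, HYPOTHESIS-FREE**: for every numeral `N`,
`D1Drift Lc (JsBalAn1 r c⃗ … cB Tc) N μ ν ↔ γ(r) + φ(c⃗) + cB·σ(r) + λ(Tc) = stepBal N Lc` in the notation of `lim_fourPieces`. -/
theorem d1Drift_iff_fourPieces (hLc : 2 ≤ Lc) (hr : r ∈ box (3 + 1) Lc) (hr₀ : r₀ ∈ box (3 + 1) Lc) (cE cVH cΛ cB : ℝ)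
    (Tc : Fin 4 → Fin 4 → Fin 4 → Fin 4 → ℝ) (μ ν : Fin 4) (N : ℝ) :
    D1Drift Lc (JsBalAn1 (one_le_of_two_le hLc) hr cE cVH cΛ ((Lc : ℝ) ^ (2 * (3 + 1))) cB Tc) N μ ν ↔
      CauchyRate.lim (fun j => B12Beta.secondMoment (TbalOf Lc (JsBalAn1 (one_le_of_two_le hLc) hr 0 0 0 ((Lc : ℝ) ^ (2 * (3 + 1))) 0 0) j) μ ν) +
          (CauchyRate.lim (fun j => B12Beta.secondMoment (TbalOf Lc (JsBalAn1 (one_le_of_two_le hLc) hr₀ cE cVH cΛ ((Lc : ℝ) ^ (2 * (3 + 1))) 0 0) j) μ ν) - CauchyRate.lim (fun j => B12Beta.secondMoment (TbalOf Lc (JsBalAn1 (one_le_of_two_le hLc) hr₀ 0 0 0 ((Lc : ℝ) ^ (2 * (3 + 1))) 0 0) j) μ ν)) +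
          cB * (CauchyRate.lim (fun j => B12Beta.secondMoment (TbalOf Lc (JsBalAn1 (one_le_of_two_le hLc) hr 0 0 0 ((Lc : ℝ) ^ (2 * (3 + 1))) 1 0) j) μ ν) - CauchyRate.lim (fun j => B12Beta.secondMoment (TbalOf Lc (JsBalAn1 (one_le_of_two_le hLc) hr 0 0 0 ((Lc : ℝ) ^ (2 * (3 + 1))) 0 0) j) μ ν)) +
          (CauchyRate.lim (fun j => B12Beta.secondMoment (TbalOf Lc (JsBalAn1 (one_le_of_two_le hLc) hr₀ 0 0 0 ((Lc : ℝ) ^ (2 * (3 + 1))) 0 Tc) j) μ ν) - CauchyRate.lim (fun j => B12Beta.secondMoment (TbalOf Lc (JsBalAn1 (one_le_of_two_le hLc) hr₀ 0 0 0 ((Lc : ℝ) ^ (2 * (3 + 1))) 0 0) j) μ ν)) =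
        B12Normalization.stepBal N Lc := by
  rw [d1Drift_pinned_iff_lim_eq hLc hr cE cVH cΛ cB Tc μ ν N, lim_fourPieces hLc hr hr₀ cE cVH cΛ cB Tc μ ν]

/-! ## §2 (D1) at the pinned literal in normal form -/

/-- [folklore] **(D1) AT THE PINNED LITERAL IN NORMAL FORM, HYPOTHESIS-FREE**: for every numeral `N`,
`D1Drift Lc (JsBalAn1 r c⃗ … cB Tc) N μ ν ↔ lim β⁰(r,c⃗;0,0) + cB·σ_r + λ(Tc) = stepBal N Lc` (g1-p3's `d1Drift_pinned_iff_lim_eq` + §1). -/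
theorem d1Drift_iff_normalForm (hLc : 2 ≤ Lc) (hr : r ∈ box (3 + 1) Lc) (hr₀ : r₀ ∈ box (3 + 1) Lc) (cE cVH cΛ cB : ℝ)
    (Tc : Fin 4 → Fin 4 → Fin 4 → Fin 4 → ℝ) (μ ν : Fin 4) (N : ℝ) :
    D1Drift Lc (JsBalAn1 (one_le_of_two_le hLc) hr cE cVH cΛ ((Lc : ℝ) ^ (2 * (3 + 1))) cB Tc) N μ ν ↔
      CauchyRate.lim (fun j => B12Beta.secondMoment (TbalOf Lc (JsBalAn1 (one_le_of_two_le hLc) hr cE cVH cΛ ((Lc : ℝ) ^ (2 * (3 + 1))) 0 0) j) μ ν) +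
          cB * (CauchyRate.lim (fun j => B12Beta.secondMoment (TbalOf Lc (JsBalAn1 (one_le_of_two_le hLc) hr 0 0 0 ((Lc : ℝ) ^ (2 * (3 + 1))) 1 0) j) μ ν) - CauchyRate.lim (fun j => B12Beta.secondMoment (TbalOf Lc (JsBalAn1 (one_le_of_two_le hLc) hr 0 0 0 ((Lc : ℝ) ^ (2 * (3 + 1))) 0 0) j) μ ν)) +
          (CauchyRate.lim (fun j => B12Beta.secondMoment (TbalOf Lc (JsBalAn1 (one_le_of_two_le hLc) hr₀ 0 0 0 ((Lc : ℝ) ^ (2 * (3 + 1))) 0 Tc) j) μ ν) - CauchyRate.lim (fun j => B12Beta.secondMoment (TbalOf Lc (JsBalAn1 (one_le_of_two_le hLc) hr₀ 0 0 0 ((Lc : ℝ) ^ (2 * (3 + 1))) 0 0) j) μ ν)) =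
        B12Normalization.stepBal N Lc := by
  rw [d1Drift_pinned_iff_lim_eq hLc hr cE cVH cΛ cB Tc μ ν N, lim_normalForm hLc hr hr₀ cE cVH cΛ cB Tc μ ν]

/-! ## §3 The trichotomy -/

/-- [folklore] **CASE A — THE BORDER SLOPE IS NON-ZERO: (D1) DEFINES THE BORDER WEIGHT AT EVERY MEMBER OVER THE ROOT, HYPOTHESIS-FREE**: if
`σ_r = lim β⁰(r,0⃗;1,0) − lim β⁰(r,0⃗;0,0) ≠ 0` then for every colour triple, every position table and every numeral there is EXACTLY ONE border weight `cB` with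
`D1Drift Lc (JsBalAn1 r c⃗ … cB Tc) N μ ν` (GEN 9's `existsUnique_borderWeight_d1Drift`, its genericity hypothesis transported from `(0⃗, 0)` to `(c⃗, Tc)` by the modular law
and the universality of the response). -/
theorem existsUnique_borderWeight_of_sigma_ne (hLc : 2 ≤ Lc) (hr : r ∈ box (3 + 1) Lc) (μ ν : Fin 4)
    (hσ : CauchyRate.lim (fun j => B12Beta.secondMoment (TbalOf Lc (JsBalAn1 (one_le_of_two_le hLc) hr 0 0 0 ((Lc : ℝ) ^ (2 * (3 + 1))) 1 0) j) μ ν) ≠ CauchyRate.lim (fun j => B12Beta.secondMoment (TbalOf Lc (JsBalAn1 (one_le_of_two_le hLc) hr 0 0 0 ((Lc : ℝ) ^ (2 * (3 + 1))) 0 0) j) μ ν))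
    (cE cVH cΛ : ℝ) (Tc : Fin 4 → Fin 4 → Fin 4 → Fin 4 → ℝ) (N : ℝ) :
    ∃! cB : ℝ, D1Drift Lc (JsBalAn1 (one_le_of_two_le hLc) hr cE cVH cΛ ((Lc : ℝ) ^ (2 * (3 + 1))) cB Tc) N μ ν := by
  refine D1PinnedBorderWeightAffine.existsUnique_borderWeight_d1Drift hLc hr cE cVH cΛ Tc μ ν (fun h => hσ ?_) N
  have hmod := lim_JsBalAn1_secondOrder_modular hLc hr cE cVH cΛ 1 Tc μ ν
  have hσ' := lim_JsBalAn1_response_universal hLc hr cE cVH cΛ 0 0 0 1 0 μ ν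
  linear_combination h - hmod - hσ'

/-- [folklore] **CASE B — ZERO BORDER SLOPE, NON-ZERO TABLE RESPONSE: (D1) IS AN AFFINE HYPERPLANE CONDITION ON THE POSITION TABLE, HYPOTHESIS-FREE**: if `σ_r = 0` plays no
role here — whenever `λ(T) = lim β⁰(r₀,0⃗;0,T) − lim β⁰(r₀,0⃗;0,0) ≠ 0` for SOME table `T` (at any reference root `r₀`), then for every colour triple, every border weight and
every numeral SOME position table meets (D1) and SOME position table misses it (the sibling's `exists_tableLine_lim_eq` on the line through `0` and `T`, its genericity
hypothesis transported by the universality of the table response). -/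
theorem exists_table_met_and_missed_of_lambda_ne (hLc : 2 ≤ Lc) (hr : r ∈ box (3 + 1) Lc) (hr₀ : r₀ ∈ box (3 + 1) Lc) (μ ν : Fin 4)
    {T : Fin 4 → Fin 4 → Fin 4 → Fin 4 → ℝ} (hlam : CauchyRate.lim (fun j => B12Beta.secondMoment (TbalOf Lc (JsBalAn1 (one_le_of_two_le hLc) hr₀ 0 0 0 ((Lc : ℝ) ^ (2 * (3 + 1))) 0 T) j) μ ν) ≠ CauchyRate.lim (fun j => B12Beta.secondMoment (TbalOf Lc (JsBalAn1 (one_le_of_two_le hLc) hr₀ 0 0 0 ((Lc : ℝ) ^ (2 * (3 + 1))) 0 0) j) μ ν))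
    (cE cVH cΛ cB : ℝ) (N : ℝ) :
    (∃ Tc : Fin 4 → Fin 4 → Fin 4 → Fin 4 → ℝ, D1Drift Lc (JsBalAn1 (one_le_of_two_le hLc) hr cE cVH cΛ ((Lc : ℝ) ^ (2 * (3 + 1))) cB Tc) N μ ν) ∧
    (∃ Tc : Fin 4 → Fin 4 → Fin 4 → Fin 4 → ℝ, ¬ D1Drift Lc (JsBalAn1 (one_le_of_two_le hLc) hr cE cVH cΛ ((Lc : ℝ) ^ (2 * (3 + 1))) cB Tc) N μ ν) := by
  have hgen : CauchyRate.lim (fun j => B12Beta.secondMoment (TbalOf Lc (JsBalAn1 (one_le_of_two_le hLc) hr cE cVH cΛ ((Lc : ℝ) ^ (2 * (3 + 1))) cB T) j) μ ν) ≠ CauchyRate.lim (fun j => B12Beta.secondMoment (TbalOf Lc (JsBalAn1 (one_le_of_two_le hLc) hr cE cVH cΛ ((Lc : ℝ) ^ (2 * (3 + 1))) cB 0) j) μ ν) := by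
    intro h
    apply hlam
    linear_combination h - lim_JsBalAn1_tableResponse_universal hLc hr hr₀ cE cVH cΛ 0 0 0 cB 0 T μ ν
  obtain ⟨s₁, hs₁⟩ := D1PinnedPositionTableAffine.exists_tableLine_lim_eq hLc hr cE cVH cΛ cB 0 T μ ν hgen (B12Normalization.stepBal N Lc)
  obtain ⟨s₂, hs₂⟩ := D1PinnedPositionTableAffine.exists_tableLine_lim_eq hLc hr cE cVH cΛ cB 0 T μ ν hgen (B12Normalization.stepBal N Lc + 1)
  refine ⟨⟨(1 - s₁) • (0 : Fin 4 → Fin 4 → Fin 4 → Fin 4 → ℝ) + s₁ • T, (d1Drift_pinned_iff_lim_eq hLc hr cE cVH cΛ cB _ μ ν N).mpr hs₁⟩,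
    ⟨(1 - s₂) • (0 : Fin 4 → Fin 4 → Fin 4 → Fin 4 → ℝ) + s₂ • T, fun hD => ?_⟩⟩
  have h := (d1Drift_pinned_iff_lim_eq hLc hr cE cVH cΛ cB _ μ ν N).mp hD
  rw [hs₂] at h
  linarith

/-- [folklore] **CASE C — ZERO BORDER SLOPE AND ZERO TABLE RESPONSE: (D1) AT THE PINNED LITERAL SEES NONE OF ITS FREE SECOND-ORDER DATA, HYPOTHESIS-FREE**: if `σ_r = 0` and
`λ = 0` then for every colour triple, border weight, table and numeral, `D1Drift Lc (JsBalAn1 r c⃗ … cB Tc) N μ ν ↔ D1Drift Lc (JsBalAn1 r c⃗ … 0 0) N μ ν` — (D1) at the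
literal is then a statement about `(cE, cVH, cΛ)` alone. -/
theorem d1Drift_iff_base_of_sigma_eq_lambda_eq (hLc : 2 ≤ Lc) (hr : r ∈ box (3 + 1) Lc) (hr₀ : r₀ ∈ box (3 + 1) Lc) (μ ν : Fin 4)
    (hσ : CauchyRate.lim (fun j => B12Beta.secondMoment (TbalOf Lc (JsBalAn1 (one_le_of_two_le hLc) hr 0 0 0 ((Lc : ℝ) ^ (2 * (3 + 1))) 1 0) j) μ ν) = CauchyRate.lim (fun j => B12Beta.secondMoment (TbalOf Lc (JsBalAn1 (one_le_of_two_le hLc) hr 0 0 0 ((Lc : ℝ) ^ (2 * (3 + 1))) 0 0) j) μ ν))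
    (hlam : ∀ T : Fin 4 → Fin 4 → Fin 4 → Fin 4 → ℝ, CauchyRate.lim (fun j => B12Beta.secondMoment (TbalOf Lc (JsBalAn1 (one_le_of_two_le hLc) hr₀ 0 0 0 ((Lc : ℝ) ^ (2 * (3 + 1))) 0 T) j) μ ν) = CauchyRate.lim (fun j => B12Beta.secondMoment (TbalOf Lc (JsBalAn1 (one_le_of_two_le hLc) hr₀ 0 0 0 ((Lc : ℝ) ^ (2 * (3 + 1))) 0 0) j) μ ν))
    (cE cVH cΛ cB : ℝ) (Tc : Fin 4 → Fin 4 → Fin 4 → Fin 4 → ℝ) (N : ℝ) :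
    D1Drift Lc (JsBalAn1 (one_le_of_two_le hLc) hr cE cVH cΛ ((Lc : ℝ) ^ (2 * (3 + 1))) cB Tc) N μ ν ↔
      D1Drift Lc (JsBalAn1 (one_le_of_two_le hLc) hr cE cVH cΛ ((Lc : ℝ) ^ (2 * (3 + 1))) 0 0) N μ ν := by
  rw [d1Drift_pinned_iff_lim_eq hLc hr cE cVH cΛ cB Tc μ ν N, d1Drift_pinned_iff_lim_eq hLc hr cE cVH cΛ 0 0 μ ν N,
    lim_normalForm hLc hr hr₀ cE cVH cΛ cB Tc μ ν, hσ, hlam Tc]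
  constructor
  · intro h; linear_combination h
  · intro h; linear_combination h

/-- [folklore] **THE THREE CASES EXHAUST, HYPOTHESIS-FREE** (excluded middle on the two universal numbers ∕ functional): for every root `r` and channel, EITHER (A) `σ_r ≠ 0`, OR
(B) `σ_r = 0` and `λ(T) ≠ 0` for some `T`, OR (C) `σ_r = 0` and `λ = 0` — recorded as a disjunction so that the census can point at ONE decidable-by-computation datum per case. -/
theorem trichotomy (hLc : 2 ≤ Lc) (hr : r ∈ box (3 + 1) Lc) (hr₀ : r₀ ∈ box (3 + 1) Lc) (μ ν : Fin 4) :
    CauchyRate.lim (fun j => B12Beta.secondMoment (TbalOf Lc (JsBalAn1 (one_le_of_two_le hLc) hr 0 0 0 ((Lc : ℝ) ^ (2 * (3 + 1))) 1 0) j) μ ν) ≠ CauchyRate.lim (fun j => B12Beta.secondMoment (TbalOf Lc (JsBalAn1 (one_le_of_two_le hLc) hr 0 0 0 ((Lc : ℝ) ^ (2 * (3 + 1))) 0 0) j) μ ν) ∨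
    (CauchyRate.lim (fun j => B12Beta.secondMoment (TbalOf Lc (JsBalAn1 (one_le_of_two_le hLc) hr 0 0 0 ((Lc : ℝ) ^ (2 * (3 + 1))) 1 0) j) μ ν) = CauchyRate.lim (fun j => B12Beta.secondMoment (TbalOf Lc (JsBalAn1 (one_le_of_two_le hLc) hr 0 0 0 ((Lc : ℝ) ^ (2 * (3 + 1))) 0 0) j) μ ν) ∧
      ∃ T : Fin 4 → Fin 4 → Fin 4 → Fin 4 → ℝ, CauchyRate.lim (fun j => B12Beta.secondMoment (TbalOf Lc (JsBalAn1 (one_le_of_two_le hLc) hr₀ 0 0 0 ((Lc : ℝ) ^ (2 * (3 + 1))) 0 T) j) μ ν) ≠ CauchyRate.lim (fun j => B12Beta.secondMoment (TbalOf Lc (JsBalAn1 (one_le_of_two_le hLc) hr₀ 0 0 0 ((Lc : ℝ) ^ (2 * (3 + 1))) 0 0) j) μ ν)) ∨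
    (CauchyRate.lim (fun j => B12Beta.secondMoment (TbalOf Lc (JsBalAn1 (one_le_of_two_le hLc) hr 0 0 0 ((Lc : ℝ) ^ (2 * (3 + 1))) 1 0) j) μ ν) = CauchyRate.lim (fun j => B12Beta.secondMoment (TbalOf Lc (JsBalAn1 (one_le_of_two_le hLc) hr 0 0 0 ((Lc : ℝ) ^ (2 * (3 + 1))) 0 0) j) μ ν) ∧
      ∀ T : Fin 4 → Fin 4 → Fin 4 → Fin 4 → ℝ, CauchyRate.lim (fun j => B12Beta.secondMoment (TbalOf Lc (JsBalAn1 (one_le_of_two_le hLc) hr₀ 0 0 0 ((Lc : ℝ) ^ (2 * (3 + 1))) 0 T) j) μ ν) = CauchyRate.lim (fun j => B12Beta.secondMoment (TbalOf Lc (JsBalAn1 (one_le_of_two_le hLc) hr₀ 0 0 0 ((Lc : ℝ) ^ (2 * (3 + 1))) 0 0) j) μ ν)) := by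
  by_cases hσ : CauchyRate.lim (fun j => B12Beta.secondMoment (TbalOf Lc (JsBalAn1 (one_le_of_two_le hLc) hr 0 0 0 ((Lc : ℝ) ^ (2 * (3 + 1))) 1 0) j) μ ν) = CauchyRate.lim (fun j => B12Beta.secondMoment (TbalOf Lc (JsBalAn1 (one_le_of_two_le hLc) hr 0 0 0 ((Lc : ℝ) ^ (2 * (3 + 1))) 0 0) j) μ ν)
  · by_cases hlam : ∀ T : Fin 4 → Fin 4 → Fin 4 → Fin 4 → ℝ, CauchyRate.lim (fun j => B12Beta.secondMoment (TbalOf Lc (JsBalAn1 (one_le_of_two_le hLc) hr₀ 0 0 0 ((Lc : ℝ) ^ (2 * (3 + 1))) 0 T) j) μ ν) = CauchyRate.lim (fun j => B12Beta.secondMoment (TbalOf Lc (JsBalAn1 (one_le_of_two_le hLc) hr₀ 0 0 0 ((Lc : ℝ) ^ (2 * (3 + 1))) 0 0) j) μ ν)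
    · exact Or.inr (Or.inr ⟨hσ, hlam⟩)
    · obtain ⟨T, hT⟩ := not_forall.mp hlam
      exact Or.inr (Or.inl ⟨hσ, T, hT⟩)
  · exact Or.inl hσ

end Summit.QuantumFields.BalabanUV.Gaps.D1PinnedSecondOrderNormalForm

end
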